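import Summits.BirchSwinnertonDyer.BirchSwinnertonDyer.Theorems.KolyvaginDepthDoorDepthTableSteinWuthrichEvenRankBSDQuotientESided
import Literature.NumberTheory.EllipticCurves.ShaPTorsionVanishingHigherRank
import Literature.NumberTheory.EllipticCurves.LFunctionSmulProofs
import Literature.NumberTheory.EllipticCurves.BSDInvariantsProofs
import Literature.NumberTheory.EllipticCurves.BSDInvariantsRegulatorProofs
import HarnessLib

/-!
# Route `KolyvaginDepthDoor`, crux `KolyvaginDepthSupplyKN` (stmt-BirchSwinnertonDyer-22820) —
# DEPTH TABLE v16, GENERIC: THE INTRINSIC FORM OF THE EVEN-RANK ROW — the twist model enters ONLY through its datum;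
# ONE class-wide theorem per supply (W. Zhang's ♠ cell / Castella–Sano's split cell), EVERY Heegner field, EVERY admissible prime

Helper file of the lead prover of line `levelone` (kdd-p1 g20; `--supports stmt-BirchSwinnertonDyer-22820
--as helper`); it closes nothing and BSD is NOT proved by it.

g19's even-rank mechanism (`cruxBody_of_twistBSDQuotient_le_of_steinWuthrich_bcs[_ESided]`) still asked, on the chosen globally
minimal model `T` of the Heegner twist `E^{(d_K)}`, (a) a Kodaira–Néron hypothesis `p ∤ ord_v Δ_min(T)` at the multiplicative places,
(b) (E-sided version) `d_K` square-free, (c) `ord_{s=1} L(T,s) = 1` on that model. All three are bookkeeping: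

* (a) is IDLE for the direction the rows use. Burungale–Castella–Skinner's identity reads `ord_p(L'(T,1)/(Ω_T Reg_T)) = ord_p #Ш(T)
  + ord_p Tam(T)`; the Tamagawa term is `≥ 0`, so `ord_p(quotient) ≤ k` gives `ord_p #Ш(T) ≤ k` with NO condition on `Tam(T)`
  (`natCard_selmerGroup_le_pow_succ_of_rankOne_bsdQuotient_bcs'`). Kodaira–Néron on the twist is needed only for the CONVERSE
  (exact) rows.
* (b): every non-zero integer is `m·e²` with `m` square-free (`Nat.sq_mul_squarefree_of_pos`), `E^{(m e²)} ≅ E^{(m)}`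
  (`exists_variableChange_quadraticTwist_mul_sq`), and the PROVED twisting formula `a_p(E^{(m)}) = (m/p) a_p(E)`
  (`frobeniusTrace_quadraticTwist_holds`) carries good ordinary reduction to any model of the twist for EVERY `d_K` with `p ∤ 2 d_K`
  (`goodOrdinary_of_smul_eq_quadraticTwist_of_ne_zero`) — the even discriminants `−8, −52, −68, …` included.
* (c): `ord_{s=1} L` is an isomorphism invariant (`analyticRank_smul`), so it is read on the canonical twist `W.quadraticTwist d_K`;
  and the datum itself does not depend on the minimal model chosen (`bsdQuotient_eq_of_isGloballyMinimal`: two globally minimal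
  models have the same `L^{(r)}(1)/r!`, the same real period and the same regulator — tree theorems `leadingLCoeff_smul`,
  `realPeriodRat_variableChange_of_isGloballyMinimal_holds`, `regulator_variableChange_holds`).

Hence the INTRINSIC even-rank mechanisms, in which the twist model `T` carries NO arithmetic hypothesis at all:

* `cruxBody_of_twistBSDQuotient_intrinsic_spade` — ♠ supply (W. Zhang L8.4 (1) by name): `W` globally minimal, non-CM, `2 ≤ rank`,
  `N_E ≤ 30 000`; `5 ≤ p < 1000` good ordinary, `ρ_{W,p^n}` onto, Kodaira–Néron, ♠ (1), ♠ (2); `K` ANY imaginary quadratic Heegner field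
  with `d_K ∉ {−3,−4}`, `p ∤ d_K`; `T` ANY globally minimal model of `E^{(d_K)}`; IF `ord_{s=1} L(E^{(d_K)}, s) = 1` and
  `ord_p(L'(T,1)/(Ω_T Reg_T)) ≤ k` with `k + 1 ≤ rank W` THEN the clause of `KolyvaginDepthSupplyKN` holds at `W` VERBATIM.
* the SPLIT-supply analogues (Castella–Sano Thm. 3, no ♠; `664a1`, `916c1`, `944e1` and every curve at a split prime) are in the
  companion file `KolyvaginDepthDoorDepthTableIntrinsicSplit`.

So, for EVERY non-CM rank-`≥ 2` curve of conductor `≤ 30 000` on the ♠ cell, EVERY Heegner field and EVERY admissible `p`: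
the crux `KolyvaginDepthSupplyKN` holds at the curve as soon as the ONE rank-one twist `E^{(d_K)}` has `ord_p(BSD quotient) ≤ rank − 1`
— the per-curve rows of v13–v15 are instances, and their minimal-twist-model certificates are no longer needed for this direction.

CONDITIONAL on Stein–Wuthrich 2013 Thm. 1.1, W. Zhang 2014 L8.4 (1) / 9.1, Burungale–Castella–Skinner 2025 Cor. 1.3.1 and GZK, BY NAME;
per `(W, p, K)`; nothing class-wide on the open stub (S♭); BSD is NOT proved by any of this.

References: [BurungaleCastellaSkinner2025] Cor. 1.3.1 (p. 4); [Darmon2004] Thm. 3.22; [SteinWuthrich2013] Thm. 1.1 (p. 1758);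
[WZhang2014] Lemma 8.4 (1) (p. 236), Thm. 9.1 (p. 240); [Knapp1993] Prop. 12.10; [SilvermanAEC2009] VII.1 Prop. 1.3(b), VIII.8.3, X.4.2,
X.5 Cor. 5.4, App. C §16.
-/

set_option linter.dupNamespace false

noncomputable section

open scoped Classical NumberField

namespace Summit.BirchSwinnertonDyer.BirchSwinnertonDyer.Theorems.KolyvaginDepthDoor

open Literature.NumberTheory.EllipticCurves Literature.NumberTheory.EllipticCurves.ModularForms
  WeierstrassCurve NumberField IsDedekindDomain
open Literature.NumberTheory.EllipticCurves.Rank1Residual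
open Summit.BirchSwinnertonDyer.BirchSwinnertonDyer.Theorems

/-! ## (a) The BCS bound without Kodaira–Néron on the twist -/

/-- **EVEN rank, with tolerance, NO Kodaira–Néron hypothesis: `#Sel_p(T/ℚ) ≤ p^{k+1}` from `ord_p(L'(T,1)/(Ω_T·Reg_T)) ≤ k`**
(Burungale–Castella–Skinner 2025 Cor. 1.3.1 + GZK by name). As g19's `natCard_selmerGroup_le_pow_succ_of_rankOne_bsdQuotient_bcs` but
WITHOUT `p ∤ ord_v Δ_min(T)`: BCS's identity `ord_p(quotient) = ord_p #Ш(T) + ord_p Tam(T)` has a non-negative Tamagawa term, so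
`ord_p #Ш(T) ≤ k` follows from `ord_p(quotient) ≤ k` alone; then `#Ш(T)[p] ≤ p^k` (Lagrange + Cauchy) and `#Sel_p(T) = p · #T(ℚ)[p] ·
#Ш(T)[p] ≤ p^{k+1}` (`T(ℚ)[p] = 0` by irreducibility). CONDITIONAL on the two named facts; per `(T, p)`; BSD is not proved by it.
[cite: BurungaleCastellaSkinner2025, Cor. 1.3.1 (p. 4)] [cite: Darmon2004, Thm. 3.22] [cite: SilvermanAEC2009, Thm. X.4.2] -/
theorem natCard_selmerGroup_le_pow_succ_of_rankOne_bsdQuotient_bcs'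
    (hBCS : BurungaleCastellaSkinner2025.cor131_padicValRat_bsd_rank_le_one)
    (hGZK : rank_eq_analyticRank_of_analyticRank_le_one)
    (T : WeierstrassCurve ℚ) [T.IsElliptic] [T.IsGloballyMinimal] (p : ℕ) [hp : Fact p.Prime] (h5 : 5 ≤ p)
    (hcm : ¬ T.HasCM) (hgood : T.HasGoodReductionAtPrime p) (hord : ¬ (p : ℤ) ∣ T.frobeniusTrace p)
    (hsur : T.HasSurjectiveModNGaloisRep p)
    (hr : T.analyticRank = 1) (k : ℕ)
    (hval : ∀ q : ℚ, T.leadingLCoeff / ((T.realPeriodRat * T.regulator : ℝ) : ℂ) = (q : ℂ) → padicValRat p q ≤ k) :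
    Nat.card (T.selmerGroup p) ≤ p ^ (k + 1) := by
  have hirr : T.HasIrreducibleModPGaloisRep p := hasIrreducibleModPGaloisRep_of_hasSurjectiveModNGaloisRep T p hsur
  have him : BigIm T p := Summit.BirchSwinnertonDyer.Rank1Residual.X9.bigIm_of_surj T p h5 hsur
  obtain ⟨hrank, hfin⟩ := hGZK T (by rw [hr])
  rw [hr] at hrank
  haveI : Finite T.sha := hfin
  obtain ⟨q, hq, hv⟩ := hBCS T p hcm (by omega) ⟨hgood, hord⟩ hirr him (by rw [hr]) hfin
  have hvk : padicValRat p q ≤ k := hval q hq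
  -- BCS: `ord_p q = ord_p #Ш + ord_p Tam`; the Tamagawa term is `≥ 0`, so `ord_p #Ш ≤ k` (no Kodaira–Néron needed)
  have hshak : padicValNat p T.shaOrder ≤ k := by
    have : ((padicValNat p T.shaOrder : ℕ) : ℤ) + ((padicValNat p T.tamagawaProduct : ℕ) : ℤ) ≤ k := by rw [← hv]; exact hvk
    omega
  have htor : Nat.card (AddSubgroup.torsionBy T.toAffine.Point (p : ℤ)) = 1 :=
    natCard_torsionBy_eq_one_of_hasIrreducibleModPGaloisRep T p hirr
  have hsha : Nat.card (T.sha ⊓ AddSubgroup.torsionBy T.galH1 (p : ℤ) : AddSubgroup T.galH1) ≤ p ^ k :=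
    (natCard_sha_inf_torsionBy_le_pow_padicValNat T p).trans
      (Nat.pow_le_pow_right hp.out.pos (by rwa [WeierstrassCurve.shaOrder] at hshak))
  have h := T.natCard_selmerGroup_eq hp.out.ne_zero
  rw [hrank, pow_one] at h
  rw [h]
  have key : ∀ {t s : ℕ}, t = 1 → s ≤ p ^ k → p * t * s ≤ p ^ (k + 1) := by
    rintro t s rfl hs
    rw [mul_one, pow_succ']
    exact Nat.mul_le_mul_left _ hs
  exact key (by convert htor) hsha

/-! ## (b) Good ordinary reduction of any model of `E^{(d)}` for ANY non-zero integer `d` with `p ∤ 2d` -/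

/-- **Good ORDINARY reduction of a twist model at `p ∤ 2d` from that of the curve, for EVERY non-zero integer `d`** (not only
square-free ones): write `|d| = e²·m₀` with `m₀` square-free (`Nat.sq_mul_squarefree_of_pos`), `m = sign(d)·m₀`; then
`E^{(d)} = E^{(m e²)} ≅ E^{(m)}` over `ℚ` (`exists_variableChange_quadraticTwist_mul_sq`), so `T` is a model of `E^{(m)}` too and g19's
square-free lemma `goodOrdinary_of_smul_eq_quadraticTwist` (twisting formula `a_p = (m/p)·a_p(W)`) applies (`p ∤ 2m` since `m ∣ d`).
[cite: Knapp1993, Prop. 12.10 (PDF pp. 302–303)] [cite: SilvermanAEC2009, X.5 Cor. 5.4] -/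
theorem goodOrdinary_of_smul_eq_quadraticTwist_of_ne_zero (W T : WeierstrassCurve ℚ) [W.IsElliptic] [W.IsGloballyMinimal]
    [T.IsElliptic] [T.IsGloballyMinimal] {d : ℤ} (hd : d ≠ 0) {C : VariableChange ℚ}
    (hC : C • T = W.quadraticTwist (d : ℚ)) (p : ℕ) [hp : Fact p.Prime] (hpd : ¬ (p : ℤ) ∣ 2 * d)
    (hgood : W.HasGoodReductionAtPrime p) (hord : ¬ (p : ℤ) ∣ W.frobeniusTrace p) :
    T.HasGoodReductionAtPrime p ∧ ¬ (p : ℤ) ∣ T.frobeniusTrace p := by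
  -- square-class reduction `d = m · e²`, `m` square-free
  obtain ⟨m₀, e, hm₀, he, hem, hsq⟩ := Nat.sq_mul_squarefree_of_pos (Int.natAbs_pos.mpr hd)
  set m : ℤ := d.sign * (m₀ : ℤ) with hm
  have hsign : d.sign.natAbs = 1 := Int.natAbs_sign_of_ne_zero hd
  have hmsq : Squarefree m := by
    rw [← Int.squarefree_natAbs, hm, Int.natAbs_mul, hsign, one_mul, Int.natAbs_natCast]
    exact hsq
  have hdme : d = m * (e : ℤ) ^ 2 := by
    have h1 : (d.natAbs : ℤ) = ((e : ℤ) ^ 2) * (m₀ : ℤ) := by exact_mod_cast hem.symm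
    calc d = d.sign * (d.natAbs : ℤ) := (Int.sign_mul_natAbs d).symm
      _ = m * (e : ℤ) ^ 2 := by rw [h1, hm]; ring
  have hmd : m ∣ d := ⟨(e : ℤ) ^ 2, hdme⟩
  have hp2m : ¬ (p : ℤ) ∣ 2 * m := fun h ↦ hpd (dvd_trans h (mul_dvd_mul_left 2 hmd))
  -- `E^{(d)} ≅ E^{(m)}` over `ℚ`
  have he0 : ((e : ℤ) : ℚ) ≠ 0 := by exact_mod_cast (Nat.pos_iff_ne_zero.mp he)
  obtain ⟨C₁, hC₁⟩ := W.exists_variableChange_quadraticTwist_mul_sq (m : ℚ) ((e : ℤ) : ℚ) he0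
  have hcast : ((m : ℚ) * ((e : ℤ) : ℚ) ^ 2) = ((d : ℤ) : ℚ) := by rw [hdme]; push_cast; ring
  rw [hcast] at hC₁
  -- `(C₁⁻¹ * C) • T = W.quadraticTwist m`
  have hC' : (C₁⁻¹ * C) • T = W.quadraticTwist ((m : ℤ) : ℚ) := by
    rw [mul_smul, hC, ← hC₁, inv_smul_smul]
  exact goodOrdinary_of_smul_eq_quadraticTwist W T hmsq hC' p hp2m hgood hord

/-! ## (c) The datum does not depend on the minimal model -/

/-- **The BSD quotient `L^{(r)}(T,1)/r! / (Ω_T · Reg_T)` is the same on any two globally minimal models of one curve** (`C • T = X`,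
`C' • T' = X`): `L`-data, the real period of a global minimal equation and the regulator are isomorphism invariants (tree theorems
`leadingLCoeff_smul`, `realPeriodRat_variableChange_of_isGloballyMinimal_holds`, `regulator_variableChange_holds`). So the datum of the
intrinsic rows is a well-defined invariant of `E^{(d_K)}`. [cite: SilvermanAEC2009, VIII.8.3 with VII.1 Prop. 1.3(b), App. C §16] -/
theorem bsdQuotient_eq_of_isGloballyMinimal (X T T' : WeierstrassCurve ℚ) [T.IsElliptic] [T.IsGloballyMinimal]
    [T'.IsElliptic] [T'.IsGloballyMinimal] (C C' : VariableChange ℚ) (hC : C • T = X) (hC' : C' • T' = X) :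
    T.leadingLCoeff / ((T.realPeriodRat * T.regulator : ℝ) : ℂ) =
      T'.leadingLCoeff / ((T'.realPeriodRat * T'.regulator : ℝ) : ℂ) := by
  -- `T' = (C'⁻¹ * C) • T`
  have hTT : (C'⁻¹ * C) • T = T' := by rw [mul_smul, hC, ← hC', inv_smul_smul]
  haveI : ((C'⁻¹ * C) • T).IsGloballyMinimal := by rw [hTT]; infer_instance
  have hL : T'.leadingLCoeff = T.leadingLCoeff := by rw [← hTT]; exact leadingLCoeff_smul T (C'⁻¹ * C)
  have hΩ : T'.realPeriodRat = T.realPeriodRat := by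
    rw [← hTT]; exact realPeriodRat_variableChange_of_isGloballyMinimal_holds T (C'⁻¹ * C)
  have hR : T'.regulator = T.regulator := by
    rw [← hTT]; exact regulator_variableChange_holds T (C'⁻¹ * C)
  rw [hL, hΩ, hR]

/-! ## The intrinsic twist bound: `#Sel_p(E^{(d_K)}) ≤ p^{k+1}` with every arithmetic side condition read on `E` -/

/-- **`#Sel_p(E^{(d)}/ℚ) ≤ p^{k+1}` from ONE valuation on ANY globally minimal model of the twist, every arithmetic side condition
on `E`.** `W` globally minimal non-CM, `p ≥ 5` good ordinary for `W` with `ρ̄_{W,p}` onto, `d ≠ 0` an integer with `p ∤ d`; `T` any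
globally minimal model of `E^{(d)}` (`C • T = W.quadraticTwist d`). IF `ord_{s=1} L(E^{(d)}, s) = 1` and `ord_p(L'(T,1)/(Ω_T Reg_T))
≤ k`, THEN `#Sel_p(E^{(d)}/ℚ) ≤ p^{k+1}`: non-CM, surjectivity (`hasSurjectiveModNGaloisRep_of_smul_eq_quadraticTwist`) and good
ordinary reduction (`goodOrdinary_of_smul_eq_quadraticTwist_of_ne_zero`) of `T` are DERIVED; `r_an` moves along `C`
(`analyticRank_smul`); then (a) and Selmer transport (`natCard_selmerGroup_eq_of_variableChange`). CONDITIONAL on BCS Cor. 1.3.1 and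
GZK by name; BSD is not proved by it. [cite: BurungaleCastellaSkinner2025, Cor. 1.3.1 (p. 4)] [cite: Darmon2004, Thm. 3.22]
[cite: Knapp1993, Prop. 12.10] [cite: SilvermanAEC2009, X.4.2, X.5 Cor. 5.4] -/
theorem natCard_selmerGroup_quadraticTwist_le_of_bsdQuotient_intrinsic
    (hBCS : BurungaleCastellaSkinner2025.cor131_padicValRat_bsd_rank_le_one)
    (hGZK : rank_eq_analyticRank_of_analyticRank_le_one)
    (W : WeierstrassCurve ℚ) [W.IsElliptic] [W.IsGloballyMinimal] (hcm : ¬ W.HasCM)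
    (p : ℕ) [hp : Fact p.Prime] (h5 : 5 ≤ p) (hgood : W.HasGoodReductionAtPrime p)
    (hord : ¬ (p : ℤ) ∣ W.frobeniusTrace p) (hsur : W.HasSurjectiveModNGaloisRep p)
    {d : ℤ} (hd : d ≠ 0) (hpd : ¬ (p : ℤ) ∣ d)
    (T : WeierstrassCurve ℚ) [T.IsElliptic] [T.IsGloballyMinimal] (C : VariableChange ℚ)
    (hC : C • T = W.quadraticTwist (d : ℚ))
    (hTr : (W.quadraticTwist (d : ℚ)).analyticRank = 1) (k : ℕ)
    (hval : ∀ q : ℚ, T.leadingLCoeff / ((T.realPeriodRat * T.regulator : ℝ) : ℂ) = (q : ℂ) → padicValRat p q ≤ k) :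
    Nat.card ((W.quadraticTwist (d : ℚ)).selmerGroup p) ≤ p ^ (k + 1) := by
  have hdq : (d : ℚ) ≠ 0 := by exact_mod_cast hd
  haveI := W.isElliptic_quadraticTwist hdq
  have hpP : p.Prime := hp.out
  -- the twist model is non-CM, `ρ̄_{T,p}` onto, good ordinary at `p` — all from `W`
  have hTcm : ¬ T.HasCM := by
    intro hT
    have h1 : (C • T).HasCM := hasCM_variableChange T C hT
    rw [hC] at h1
    exact not_hasCM_quadraticTwist W hdq hcm h1
  have hTsur : T.HasSurjectiveModNGaloisRep p := hasSurjectiveModNGaloisRep_of_smul_eq_quadraticTwist W T hdq hC p hsur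
  have hp2d : ¬ ((p : ℤ) ∣ 2 * d) := by
    intro h
    rcases (Nat.prime_iff_prime_int.mp hpP).dvd_or_dvd h with h2 | h2
    · have : p = 2 := (Nat.prime_dvd_prime_iff_eq hpP Nat.prime_two).mp (by exact_mod_cast h2)
      omega
    · exact hpd h2
  obtain ⟨hTgood, hTord⟩ := goodOrdinary_of_smul_eq_quadraticTwist_of_ne_zero W T hd hC p hp2d hgood hord
  -- `r_an` along `C`
  have hTr' : T.analyticRank = 1 := by rw [← hTr, ← hC, analyticRank_smul]
  have hSelT : Nat.card (T.selmerGroup p) ≤ p ^ (k + 1) :=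
    natCard_selmerGroup_le_pow_succ_of_rankOne_bsdQuotient_bcs' hBCS hGZK T p h5 hTcm hTgood hTord hTsur hTr' k hval
  rw [← natCard_selmerGroup_eq_of_variableChange (p : ℤ) hC]
  exact hSelT

/-! ## The intrinsic even-rank mechanism on W. Zhang's ♠ cell -/

/-- **THE INTRINSIC EVEN-RANK ROW MECHANISM, ♠ SUPPLY — every Heegner field, every admissible prime, NO hypothesis on the twist model.**
`W` globally minimal, non-CM, `2 ≤ rank_ℤ W(ℚ)`, `N_E ≤ 30 000`; `5 ≤ p < 1000` good ordinary, `ρ_{W,p^n}` onto, Kodaira–Néron,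
♠ (1), ♠ (2) (in `p`-form); `K` ANY imaginary quadratic field with `d_K ∉ {−3,−4}`, `p ∤ d_K`, Heegner for `N_E` (no parity /
square-freeness asked); `T` ANY globally minimal model of `E^{(d_K)}` (`C • T = W.quadraticTwist d_K`). IF
`ord_{s=1} L(E^{(d_K)}, s) = 1` and `ord_p(L'(T,1)/(Ω_T·Reg_T)) ≤ k` for some `k + 1 ≤ rank W`, THEN the clause of
`KolyvaginDepthSupplyKN` holds at `W` VERBATIM (witnesses `p`, `K`, W. Zhang's level-one class, first sign): the twist bound
`natCard_selmerGroup_quadraticTwist_le_of_bsdQuotient_intrinsic`, then g17's `cruxBody_of_twistSelmer_of_steinWuthrich`. CONDITIONAL on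
Stein–Wuthrich Thm. 1.1, W. Zhang L8.4 (1) / 9.1, BCS 2025 Cor. 1.3.1, GZK by name; per `(W, p, K)`; nothing class-wide (the open
stub (S♭) is untouched); BSD is not proved by it. [cite: SteinWuthrich2013, Thm. 1.1 (p. 1758)]
[cite: WZhang2014, Lemma 8.4 (1) (p. 236), Thm. 9.1 (p. 240)] [cite: BurungaleCastellaSkinner2025, Cor. 1.3.1 (p. 4)]
[cite: Darmon2004, Thm. 3.22] -/
theorem cruxBody_of_twistBSDQuotient_intrinsic_spade
    (hSW : SteinWuthrich2013_sha_inf_torsionBy_eq_bot_of_two_le_rank)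
    (h84 : Literature.NumberTheory.EllipticCurves.WZhang2014_lemma84_exists_minimal_kolyvaginClass_one_selmerCard)
    (hBCS : BurungaleCastellaSkinner2025.cor131_padicValRat_bsd_rank_le_one)
    (hGZK : rank_eq_analyticRank_of_analyticRank_le_one)
    (W : WeierstrassCurve ℚ) [W.IsElliptic] [W.IsGloballyMinimal] (hcm : ¬ W.HasCM) (hr : 2 ≤ W.mordellWeilRank)
    (hN : W.conductorNorm ℤ ≤ 30000)
    (p : ℕ) [hp : Fact p.Prime] (h5 : 5 ≤ p) (hp1000 : p < 1000) (hgood : W.HasGoodReductionAtPrime p)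
    (hord : ¬ (p : ℤ) ∣ W.frobeniusTrace p)
    (htower : ∀ n : ℕ, W.HasSurjectiveModNGaloisRep (p ^ n : ℕ))
    (hKN : ∀ v : HeightOneSpectrum (𝓞 ℚ), W.HasMultiplicativeReductionAt v →
      ¬ p ∣ W.ordMinimalDiscriminant v)
    (hS1 : ∀ (ℓ : ℕ) [Fact ℓ.Prime], W.HasMultiplicativeReductionAtPrime ℓ →
      ¬ p ∣ padicValInt ℓ W.minimalDiscriminantInt)
    (hS2 : ¬ Squarefree (W.conductorNorm ℤ) →
      (∃ (ℓ : ℕ) (_ : Fact ℓ.Prime), W.HasMultiplicativeReductionAtPrime ℓ ∧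
          ¬ p ∣ padicValInt ℓ W.minimalDiscriminantInt) ∧
        ∃ (ℓ₁ ℓ₂ : ℕ) (_ : Fact ℓ₁.Prime) (_ : Fact ℓ₂.Prime), ℓ₁ ≠ ℓ₂ ∧
          W.HasMultiplicativeReductionAtPrime ℓ₁ ∧ W.HasMultiplicativeReductionAtPrime ℓ₂)
    (K : Type) [Field K] [NumberField K] (hK : IsImaginaryQuadratic K)
    (hD3 : NumberField.discr K ≠ -3) (hD4 : NumberField.discr K ≠ -4)
    (hpD : ¬ ((p : ℤ) ∣ NumberField.discr K))
    [iNZ : NeZero (W.conductorNorm ℤ)] (hH : SatisfiesHeegnerHypothesis (W.conductorNorm ℤ) K)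
    (T : WeierstrassCurve ℚ) [T.IsElliptic] [T.IsGloballyMinimal] (C : WeierstrassCurve.VariableChange ℚ)
    (hC : C • T = W.quadraticTwist (NumberField.discr K : ℚ))
    (hTr : (W.quadraticTwist (NumberField.discr K : ℚ)).analyticRank = 1)
    (k : ℕ) (hk : k + 1 ≤ W.mordellWeilRank)
    (hval : ∀ q : ℚ, T.leadingLCoeff / ((T.realPeriodRat * T.regulator : ℝ) : ℂ) = (q : ℂ) → padicValRat p q ≤ k) :
    ∃ (p : ℕ) (hp : Fact p.Prime), 5 ≤ p ∧ W.HasGoodReductionAtPrime p ∧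
      ¬ (p : ℤ) ∣ W.frobeniusTrace p ∧ (∀ n : ℕ, W.HasSurjectiveModNGaloisRep (p ^ n : ℕ)) ∧
      (∀ v : HeightOneSpectrum (𝓞 ℚ), W.HasMultiplicativeReductionAt v →
        ¬ p ∣ W.ordMinimalDiscriminant v) ∧
      ∃ (K : Type) (_ : Field K) (_ : NumberField K), IsImaginaryQuadratic K ∧
        NumberField.discr K ≠ -3 ∧ NumberField.discr K ≠ -4 ∧
        ∃ (_ : NeZero (W.conductorNorm ℤ)), SatisfiesHeegnerHypothesis (W.conductorNorm ℤ) K ∧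
        ∃ (Dt : ModularParametrizationData W (W.conductorNorm ℤ)) (β : ℤ) (ι : K →+* ℂ) (n₁ : ℕ)
          (d : KolyvaginHeegnerData Dt β ι n₁), Squarefree n₁ ∧
          (∀ q ∈ n₁.primeFactors, Zhang2014.IsKolyvaginPrime (W.conductorNorm ℤ) W K p q) ∧
          d.kolyvaginClass hp.out 1 ≠ 0 ∧
          (n₁.primeFactors.card + 1 ≤ W.mordellWeilRank ∨
            (n₁.primeFactors.card ≤ W.mordellWeilRank ∧
              n₁.primeFactors.card + 1 ≤ (W.quadraticTwist (NumberField.discr K : ℚ)).mordellWeilRank)) := by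
  have hsur : W.HasSurjectiveModNGaloisRep p := by simpa only [pow_one] using htower 1
  have hSel := natCard_selmerGroup_quadraticTwist_le_of_bsdQuotient_intrinsic hBCS hGZK W hcm p h5 hgood hord hsur
    (NumberField.discr_ne_zero K) hpD T C hC hTr k hval
  exact cruxBody_of_twistSelmer_of_steinWuthrich hSW h84 W hcm hr hN p h5 hp1000 hgood hord htower hKN hS1 hS2
    K hK hD3 hD4 hpD hH (hSel.trans (Nat.pow_le_pow_right hp.out.pos hk))

end Summit.BirchSwinnertonDyer.BirchSwinnertonDyer.Theorems.KolyvaginDepthDoor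

end
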